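import Summits.Schanuel.Schanuel.Theorems.ZilberEacMovingGraph
import Summits.Schanuel.Schanuel.Theorems.ZilberEacComplexSecondOrder
import Literature.ModelTheory.Zilber.EACDensityOscillatory
import HarnessLib

/-!
# Moving targets DE-RESONATE oscillatory graph bases: density under the second-order sign condition

Zilber's Exponential-Algebraic Closedness, case ladder (host summit Schanuel, cell `pub-schanuel`,
seat 2, gen 8).  Over an OSCILLATORY graph base `x₁ = g(x₀)` (`Re g_D(2πi q) = 0` for every
lattice direction `q`, e.g. `g = x₀²/(2πi)`) seat 1 showed that CONSTANT fibres can fail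
Mantova–Masser's density question (`EACDensityOscillatory.not_unprojectedDense_resonantParabola`:
`{x₁ = x₀²/(2πi), y₀ = 1}` is in case (dim-pi-S-1-free) but its exponential points are NOT Zariski
dense).  With a MOVING target `y₀ = A(x₀) + y₁ F(y₁, x₀)`, `deg A = d ≥ 1`, the lattice centres
acquire the real shift `d log m`, and the second-order term `m^{D-1} · d · Re ∂g_D(2πiq) · log m`
of `Re g` (seat 2 gen 2, `re_eval_le_of_secondOrder_sharp`) drives `y₁ = e^{g}` to the puncture
super-polynomially: existence is seat 2 gen 2's `exists_expPoint_of_oscillatory`, and THEOREM G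
gives DENSITY.

* `unprojectedDense_polyFibredGraph_one_oscillatory` (`s = 1`, `D = deg g ≥ 2`, `Re g_D(v) = 0`,
  `κ = d · Re ∂g_D(v) < 0`, `(A)_d(v) ≠ 0`, any `F ∈ ℂ[u, x₀]`): Zariski density.
* `unprojectedDense_movingGraph_oscillatory` (univariate: `lc(p) (σi)^{D-1}` real negative, `deg A ≥ 1`)
  and the FREE-question instance `unprojectedDensityQuestion_instance_movingGraph_oscillatory`.
* **The resonant parabola de-resonated**: `{x₁ = x₀²/(2πi), y₀ = x₀ + y₁}` (`e^{z} = z + e^{z²/(2πi)}`)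
  has DENSE exponential points (`unprojectedDense_resonantParabola_moving`), while seat 1's
  `{x₁ = x₀²/(2πi), y₀ = 1}` over the same base has not.

HONEST FRAMING: explicit instances of an OPEN question (MM24 §1); the explosion regime `κ > 0`,
constant `A` over oscillatory bases (seat 1's phase criterion), `EC(3,2)`: unchanged; NOT SC; EAC ⇏ SC.
-/

noncomputable section

open Complex MvPolynomial Filter Topology
open Literature.NumberTheory.Transcendental Literature.ModelTheory.Zilber

set_option linter.dupNamespace false

namespace Summit.Schanuel.Schanuel.Theorems

/-! ## Part 1. The general second-order density theorem (`s = 1`) -/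

section General

/-- **Density over oscillatory graph bases under the second-order sign condition.**  Let
`g ∈ ℂ[x₀]` have degree `D ≥ 2` with `Re g_D(2πiq) = 0`, let `A ∈ ℂ[x₀]` with `A_d(2πiq) ≠ 0` and
`κ := d · Re (∂g_D)(2πiq) < 0`, and `F ∈ ℂ[u, x₀]` arbitrary.  Then the exponential points of
`polyFibredGraph g A F = {x₁ = g(x₀), y₀ = A(x₀) + y₁ F(y₁, x₀)}` are Zariski dense: along the
solutions of `exists_expPoint_of_oscillatory` one has `Re x₁ ≤ (κ/2) m^{D-1} log m` and
`‖x₁‖ = O(m^{D})`, so THEOREM G applies. (new) [cite: MantovaMasser2023, §1 Further remarks] -/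
theorem unprojectedDense_polyFibredGraph_one_oscillatory (g : MvPolynomial (Fin 1) ℂ)
    (hD : 2 ≤ g.totalDegree) (q : Fin 1 → ℤ)
    (hre : (eval (fun j => 2 * Real.pi * I * (q j : ℂ)) (homogeneousComponent g.totalDegree g)).re = 0)
    (A : Fin 1 → MvPolynomial (Fin 1) ℂ)
    (hA : ∀ j, eval (fun i => 2 * Real.pi * I * (q i : ℂ))
      (homogeneousComponent (A j).totalDegree (A j)) ≠ 0)
    (hκ : ∑ j, ((A j).totalDegree : ℝ) * (eval (fun i => 2 * Real.pi * I * (q i : ℂ))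
      (pderiv j (homogeneousComponent g.totalDegree g))).re < 0)
    (F : Fin 1 → MvPolynomial (Fin (1 + 1)) ℂ) :
    UnprojectedDense (polyFibredGraph g A F) := by
  classical
  obtain ⟨m₀, hsol⟩ := eventually_atTop.1 (exists_expPoint_of_oscillatory g hD q hre A hA hκ F)
  have hsol' : ∀ m : ℕ, ∃ x : Fin 1 → ℂ,
      ‖x - fun i => ((max m m₀ : ℕ) : ℂ) * (2 * Real.pi * I * (q i : ℂ)) +
          log (eval (fun k => ((max m m₀ : ℕ) : ℂ) * (2 * Real.pi * I * (q k : ℂ))) (A i))‖ ≤ 1 / 2 ∧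
      ∀ j, exp (x j) = eval x (A j) +
        exp (eval x g) * eval (Fin.cons (exp (eval x g)) x) (F j) :=
    fun m => hsol (max m m₀) (le_max_right _ _)
  choose xs hxs using hsol'
  set p : ℕ → Fin (1 + 1) ⊕ Fin (1 + 1) → ℂ := fun m =>
    Sum.elim (Fin.snoc (xs m) (eval (xs m) g))
      (Fin.snoc (fun j => exp (xs m j)) (exp (eval (xs m) g))) with hp
  have hpS : ∀ m, p m ∈ polyFibredGraph g A F := by
    intro m
    rw [mem_polyFibredGraph_iff]
    have h1 : (fun j : Fin 1 => p m (Sum.inl (Fin.castSucc j))) = xs m := by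
      funext j; simp only [hp, Sum.elim_inl, Fin.snoc_castSucc]
    refine ⟨?_, fun j => ?_⟩
    · rw [h1]; simp only [hp, Sum.elim_inl, Fin.snoc_last]
    · rw [h1]
      simp only [hp, Sum.elim_inr, Fin.snoc_castSucc, Fin.snoc_last]
      exact (hxs m).2 j
  have hpΓ : ∀ m, p m ∈ expGraph ℂ (1 + 1) := by
    intro m
    rw [mem_expGraph_iff]
    intro i
    rw [Literature.ModelTheory.ExponentialFields.ExponentialRing.complex_exp_eq]
    rcases Fin.eq_castSucc_or_eq_last i with ⟨j, rfl⟩ | rfl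
    · simp only [hp, Sum.elim_inr, Sum.elim_inl, Fin.snoc_castSucc]
    · simp only [hp, Sum.elim_inr, Sum.elim_inl, Fin.snoc_last]
  have hdim : zariskiDim ℂ (polyFibredGraph g A F) ≤ (2 : ℕ) := (zariskiDim_polyFibredGraph g A F).le
  refine unprojectedDense_of_growth (isIrreducibleClosed_polyFibredGraph g A F) hdim (Fin.last 1)
    hpS hpΓ ?_
  have hcoord : ∀ m, p m (Sum.inl (Fin.last 1)) = eval (xs m) g := fun m => by
    simp only [hp, Sum.elim_inl, Fin.snoc_last]
  simp only [hcoord]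
  -- constants
  set D := g.totalDegree with hDdef
  set v : Fin 1 → ℂ := fun j => 2 * Real.pi * I * (q j : ℂ) with hv
  set gD := eval v (homogeneousComponent D g) with hgD
  set κ : ℝ := ∑ j, ((A j).totalDegree : ℝ) *
    (eval v (pderiv j (homogeneousComponent D g))).re with hκdef
  have hκneg : κ < 0 := hκ
  -- the logarithmic box of the solutions (as in `exists_expPoint_of_oscillatory`)
  set a : Fin 1 → ℝ := fun j => ‖eval v (homogeneousComponent (A j).totalDegree (A j))‖ with ha
  set C : ℝ := 1 + Real.pi + ∑ j, (|Real.log (a j / 2)| + |Real.log (2 * a j)|) with hCdef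
  have hsum0 : 0 ≤ ∑ j, (|Real.log (a j / 2)| + |Real.log (2 * a j)|) :=
    Finset.sum_nonneg fun j _ => by positivity
  have hC0 : 0 ≤ C := by have := Real.pi_pos; rw [hCdef]; positivity
  have hCj : ∀ j, |Real.log (a j / 2)| + |Real.log (2 * a j)| ≤
      ∑ i, (|Real.log (a i / 2)| + |Real.log (2 * a i)|) := fun j =>
    Finset.single_le_sum (f := fun i => |Real.log (a i / 2)| + |Real.log (2 * a i)|)
      (fun i _ => by positivity) (Finset.mem_univ j)
  have hbox := re_eval_le_of_secondOrder_sharp g v hD hre (fun j => (A j).totalDegree) hC0 hκ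
  -- ### (a) the second-order upper bound for `Re g(x_m)`
  have hRe : ∀ᶠ m : ℕ in atTop,
      (eval (xs m) g).re ≤ κ / 2 * (m : ℝ) ^ (D - 1) * Real.log m := by
    filter_upwards [hbox, eventually_all.2 fun j => latticeValue_eventually (A j) v (hA j),
      eventually_ge_atTop m₀] with m hm hlv hm₀
    have hmax : max m m₀ = m := max_eq_left hm₀
    have hspec := (hxs m).1
    rw [hmax] at hspec
    set ξ : Fin 1 → ℂ := xs m - fun i => (m : ℂ) * v i + log (eval (fun k => (m : ℂ) * v k) (A i))
      with hξ
    have hξn : ‖ξ‖ ≤ 1 / 2 := hspec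
    set η : Fin 1 → ℂ := (fun i => log (eval (fun k => (m : ℂ) * v k) (A i))) + ξ with hη
    have hsplit : xs m = (fun i => (m : ℂ) * v i) + η := by
      funext i; simp only [hη, hξ, Pi.add_apply, Pi.sub_apply]; ring
    rw [hsplit]
    have hξj : ∀ j, ‖ξ j‖ ≤ 1 := fun j => (norm_le_pi_norm ξ j).trans (hξn.trans (by norm_num))
    refine hm η (fun j => ?_) (fun j => ?_)
    · obtain ⟨-, ⟨h1, h2⟩, -⟩ := hlv j
      have hre' : (η j).re = Real.log ‖eval (fun k => (m : ℂ) * v k) (A j)‖ + (ξ j).re := by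
        simp only [hη, Pi.add_apply, Complex.add_re, Complex.log_re]
      have h3 : |(ξ j).re| ≤ 1 := (Complex.abs_re_le_norm _).trans (hξj j)
      rw [hre', abs_le]
      rw [abs_le] at h3
      have h4 : -|Real.log (a j / 2)| ≤ Real.log (a j / 2) := neg_abs_le _
      have h5 : Real.log (2 * a j) ≤ |Real.log (2 * a j)| := le_abs_self _
      have h6 := hCj j
      have h7 : 0 ≤ |Real.log (2 * a j)| := abs_nonneg _
      have h8 : 0 ≤ |Real.log (a j / 2)| := abs_nonneg _
      have hpi := Real.pi_pos
      constructor <;> linarith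
    · have him' : (η j).im = arg (eval (fun k => (m : ℂ) * v k) (A j)) + (ξ j).im := by
        simp only [hη, Pi.add_apply, Complex.add_im, Complex.log_im]
      have h3 : |(ξ j).im| ≤ 1 := (Complex.abs_im_le_norm _).trans (hξj j)
      have h4 : |arg (eval (fun k => (m : ℂ) * v k) (A j))| ≤ Real.pi := Complex.abs_arg_le_pi _
      rw [him']
      refine (abs_add_le _ _).trans ?_
      rw [hCdef]
      linarith
  -- ### (b) the norm bound `‖g(x_m)‖ ≤ (‖g_D(v)‖ + 1) m^D`
  obtain ⟨ρ, hρ, t₀, ht₀, hnear⟩ := ExpDominant.eval_smul_near_top g v one_pos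
  have hαev := eventually_norm_log_latticeValue_le A v hA (half_pos hρ)
  have hNorm : ∀ᶠ m : ℕ in atTop, ‖eval (xs m) g‖ ≤ (‖gD‖ + 1) * (m : ℝ) ^ D := by
    have hev2 : ∀ᶠ m : ℕ in atTop, t₀ ≤ (m : ℝ) := tendsto_natCast_atTop_atTop.eventually_ge_atTop t₀
    have hev3 : ∀ᶠ m : ℕ in atTop, 1 / ρ ≤ (m : ℝ) :=
      tendsto_natCast_atTop_atTop.eventually_ge_atTop (1 / ρ)
    filter_upwards [eventually_ge_atTop m₀, hev2, hev3, hαev] with m hm₀ hmt hmρ hα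
    have hmax : max m m₀ = m := max_eq_left hm₀
    have hspec := (hxs m).1
    rw [hmax] at hspec
    have hm0 : (0 : ℝ) < m := lt_of_lt_of_le (by positivity) hmρ
    have hmne : (m : ℂ) ≠ 0 := by exact_mod_cast hm0.ne'
    set ζ : Fin 1 → ℂ := (m : ℂ)⁻¹ • xs m - v with hζ
    have hxζ : xs m = (m : ℂ) • (v + ζ) := by
      rw [hζ, add_sub_cancel, smul_smul, mul_inv_cancel₀ hmne, one_smul]
    have hζnorm : ‖ζ‖ ≤ ρ := by
      have h1 : ζ = (m : ℂ)⁻¹ • (xs m - (m : ℂ) • v) := by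
        rw [hζ, smul_sub, smul_smul, inv_mul_cancel₀ hmne, one_smul]
      have h2 : ‖xs m - (m : ℂ) • v‖ ≤ 1 / 2 + ρ / 2 * m := by
        have hsplit : xs m - (m : ℂ) • v =
            (xs m - fun i => (m : ℂ) * (2 * Real.pi * I * (q i : ℂ)) +
              log (eval (fun k => (m : ℂ) * (2 * Real.pi * I * (q k : ℂ))) (A i))) +
            (fun i : Fin 1 => log (eval (fun k => (m : ℂ) * (2 * Real.pi * I * (q k : ℂ))) (A i))) := by
          funext j
          simp only [hv, Pi.sub_apply, Pi.add_apply, Pi.smul_apply, smul_eq_mul]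
          ring
        rw [hsplit]
        refine (norm_add_le _ _).trans (add_le_add hspec ?_)
        have hα' : ‖fun i : Fin 1 => log (eval (fun k => (m : ℂ) * v k) (A i))‖ + 1 ≤ ρ / 2 * m := hα
        simp only [hv] at hα'
        linarith [hα']
      rw [h1, norm_smul, norm_inv, Complex.norm_natCast]
      calc (m : ℝ)⁻¹ * ‖xs m - (m : ℂ) • v‖ ≤ (m : ℝ)⁻¹ * (1 / 2 + ρ / 2 * m) :=
            mul_le_mul_of_nonneg_left h2 (inv_nonneg.2 hm0.le)
        _ = (1 / 2) / m + ρ / 2 := by field_simp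
        _ ≤ ρ := by
            have h3 : (1 / 2) / (m : ℝ) ≤ ρ / 2 := by
              rw [div_le_iff₀ hm0]
              have : 1 ≤ ρ * m := by rwa [div_le_iff₀ hρ, mul_comm] at hmρ
              linarith
            linarith
    have hkey := hnear m hmt ζ hζnorm
    rw [Complex.ofReal_natCast, ← hxζ] at hkey
    calc ‖eval (xs m) g‖ ≤ ‖(m : ℂ) ^ D * gD‖ + ‖eval (xs m) g - (m : ℂ) ^ D * gD‖ :=
          norm_le_insert' _ _
      _ ≤ (m : ℝ) ^ D * ‖gD‖ + 1 * (m : ℝ) ^ D := by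
          rw [norm_mul, norm_pow, Complex.norm_natCast]
          linarith [hkey]
      _ = (‖gD‖ + 1) * (m : ℝ) ^ D := by ring
  -- ### (c) conclusion: ratio ≥ (|κ|/(2(A₀ + D))) m^{D-1} → ∞
  set A₀ : ℝ := Real.log (2 + (‖gD‖ + 1)) with hA₀
  have hApos : 0 < A₀ := Real.log_pos (by linarith [norm_nonneg gD])
  have hlow : Tendsto (fun m : ℕ => (-κ / 2) / (A₀ + D) * (m : ℝ) ^ (D - 1)) atTop atTop := by
    have hc : 0 < (-κ / 2) / (A₀ + D) := by
      have : (0 : ℝ) < A₀ + D := by positivity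
      exact div_pos (by linarith) this
    refine Tendsto.const_mul_atTop hc ?_
    have h1 : Tendsto (fun m : ℕ => ((m : ℝ)) ^ (D - 1)) atTop atTop :=
      (tendsto_pow_atTop (by omega)).comp tendsto_natCast_atTop_atTop
    exact h1
  refine tendsto_atTop_mono' atTop ?_ hlow
  have h3 : ∀ᶠ m : ℕ in atTop, (1 : ℝ) ≤ Real.log m := by
    filter_upwards [eventually_ge_atTop 3] with m hm
    have : Real.exp 1 ≤ (m : ℝ) := by
      have h := Real.exp_one_lt_d9
      have : (3 : ℝ) ≤ m := by exact_mod_cast hm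
      linarith
    calc (1 : ℝ) = Real.log (Real.exp 1) := (Real.log_exp 1).symm
      _ ≤ Real.log m := Real.log_le_log (Real.exp_pos 1) this
  filter_upwards [hRe, hNorm, h3, eventually_ge_atTop 1] with m hre' hnorm hlog1 hm1
  have hm1' : (1 : ℝ) ≤ m := by exact_mod_cast hm1
  have hm0 : (0 : ℝ) < m := by linarith
  have hmDpos : 0 < (m : ℝ) ^ D := by positivity
  have hmD1 : (0 : ℝ) ≤ (m : ℝ) ^ (D - 1) := by positivity
  -- denominator: `log(2 + ‖g‖) ≤ A₀ + D log m ≤ (A₀ + D) log m`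
  have hden : Real.log (2 + ‖eval (xs m) g‖) ≤ (A₀ + D) * Real.log m := by
    have h1 : 2 + ‖eval (xs m) g‖ ≤ (2 + (‖gD‖ + 1)) * (m : ℝ) ^ D := by
      have : (1 : ℝ) ≤ (m : ℝ) ^ D := one_le_pow₀ hm1'
      nlinarith [norm_nonneg gD]
    calc Real.log (2 + ‖eval (xs m) g‖) ≤ Real.log ((2 + (‖gD‖ + 1)) * (m : ℝ) ^ D) :=
          Real.log_le_log (by linarith [norm_nonneg (eval (xs m) g)]) h1
      _ = A₀ + D * Real.log m := by
          rw [Real.log_mul (by linarith [norm_nonneg gD]) hmDpos.ne', Real.log_pow]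
      _ ≤ (A₀ + D) * Real.log m := by nlinarith
  have hdenpos : 0 < Real.log (2 + ‖eval (xs m) g‖) :=
    Real.log_pos (by linarith [norm_nonneg (eval (xs m) g)])
  -- numerator: `|Re g| ≥ (-κ/2) m^{D-1} log m`
  have hnum : (-κ / 2) * (m : ℝ) ^ (D - 1) * Real.log m ≤ |(eval (xs m) g).re| := by
    have hneg : (eval (xs m) g).re ≤ 0 := by
      have : κ / 2 * (m : ℝ) ^ (D - 1) * Real.log m ≤ 0 := by
        have : 0 ≤ (m : ℝ) ^ (D - 1) * Real.log m := by positivity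
        nlinarith
      linarith
    rw [abs_of_nonpos hneg]
    linarith
  have hADpos : (0 : ℝ) < A₀ + D := by positivity
  calc (-κ / 2) / (A₀ + D) * (m : ℝ) ^ (D - 1)
      = ((-κ / 2) * (m : ℝ) ^ (D - 1) * Real.log m) / ((A₀ + D) * Real.log m) := by
        field_simp
    _ ≤ |(eval (xs m) g).re| / ((A₀ + D) * Real.log m) :=
        div_le_div_of_nonneg_right hnum (by positivity)
    _ ≤ |(eval (xs m) g).re| / Real.log (2 + ‖eval (xs m) g‖) :=
        div_le_div_of_nonneg_left (abs_nonneg _) hdenpos hden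

end General

/-! ## Part 2. Univariate corollaries and the de-resonated parabola -/

section Univariate

/-- The derivative of the leading form of `p.toMvPolynomial 0` at `v`: `deg p · lc(p) · v₀^{deg p - 1}`.
[folklore] -/
theorem eval_pderiv_leadingForm_toMvPolynomial_fin_one (p : Polynomial ℂ) (v : Fin 1 → ℂ) :
    eval v (pderiv 0 (homogeneousComponent (p.toMvPolynomial (0 : Fin 1)).totalDegree
      (p.toMvPolynomial (0 : Fin 1)))) =
      p.leadingCoeff * p.natDegree * v 0 ^ (p.natDegree - 1) := by
  rw [totalDegree_toMvPolynomial_fin_one, homogeneousComponent_fin_one, coeff_toMvPolynomial_fin_one,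
    Finsupp.single_eq_same, pderiv_monomial, Finsupp.single_eq_same, ← Finsupp.single_tsub,
    eval_monomial, Finsupp.prod_single_index]
  · rfl
  · exact pow_zero _

/-- **Density over oscillatory graph bases, univariate form.**  Let `p ∈ ℂ[x]` of degree `D ≥ 2`
and `σ = ±1` with `lc(p) (σ i)^{D-1}` REAL and NEGATIVE (then `Re(lc(p)(σi)^D) = 0`: the direction
`q = σ` is oscillatory, and the second-order coefficient is negative), `deg A ≥ 1`, `F ∈ ℂ[u, x₀]`
arbitrary.  Then the exponential points of `{x₁ = p(x₀), y₀ = A(x₀) + y₁ F(y₁, x₀)}` are Zariski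
dense. (new) [cite: MantovaMasser2023, §1 Further remarks] -/
theorem unprojectedDense_movingGraph_oscillatory {p : Polynomial ℂ} (hp : 2 ≤ p.natDegree) {σ : ℤ}
    (hσ : σ = 1 ∨ σ = -1) (him : (p.leadingCoeff * ((σ : ℂ) * I) ^ (p.natDegree - 1)).im = 0)
    (hneg : (p.leadingCoeff * ((σ : ℂ) * I) ^ (p.natDegree - 1)).re < 0)
    {A : Polynomial ℂ} (hA : 0 < A.natDegree) (F : MvPolynomial (Fin 2) ℂ) :
    UnprojectedDense (movingGraphSurface p A F) := by
  have hA0 : A ≠ 0 := by rintro rfl; simp at hA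
  have hσ0 : (σ : ℂ) ≠ 0 := by rcases hσ with rfl | rfl <;> simp
  have hv0 : (2 * Real.pi * I * (σ : ℂ)) ≠ 0 := by
    have hpi : (Real.pi : ℂ) ≠ 0 := Complex.ofReal_ne_zero.2 Real.pi_ne_zero
    exact mul_ne_zero (mul_ne_zero (mul_ne_zero two_ne_zero hpi) Complex.I_ne_zero) hσ0
  set q : Fin 1 → ℤ := fun _ => σ with hq
  set r : ℂ := p.leadingCoeff * ((σ : ℂ) * I) ^ (p.natDegree - 1) with hr
  have hr_real : r = ((r.re : ℝ) : ℂ) := by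
    apply Complex.ext <;> simp [him]
  obtain ⟨E, hE⟩ : ∃ E, p.natDegree = E + 1 := ⟨p.natDegree - 1, by omega⟩
  have hE' : p.natDegree - 1 = E := by omega
  have hdeg : (p.toMvPolynomial (0 : Fin 1)).totalDegree = p.natDegree :=
    totalDegree_toMvPolynomial_fin_one p
  -- oscillatory: `Re (lc (2πiσ)^D) = (2π)^D Re (r σ i) = 0`
  have hre : (eval (fun j => 2 * Real.pi * I * (q j : ℂ))
      (homogeneousComponent (p.toMvPolynomial (0 : Fin 1)).totalDegree (p.toMvPolynomial 0))).re = 0 := by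
    rw [eval_leadingForm_toMvPolynomial_fin_one]
    simp only [hq]
    have e : p.leadingCoeff * (2 * Real.pi * I * (σ : ℂ)) ^ p.natDegree =
        (((2 * Real.pi) ^ p.natDegree : ℝ) : ℂ) * (r * ((σ : ℂ) * I)) := by
      rw [hr, hE, Nat.add_sub_cancel]
      push_cast
      ring
    rw [e, Complex.re_ofReal_mul, hr_real]
    have : ((((r.re : ℝ) : ℂ)) * ((σ : ℂ) * I)).re = 0 := by
      simp [Complex.mul_re]
    rw [this, mul_zero]
  -- second-order sign: `d · Re(D lc (2πiσ)^{D-1}) = d D (2π)^{D-1} Re r < 0`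
  have hκ : ∑ j : Fin 1, (((![A.toMvPolynomial (0 : Fin 1)] : Fin 1 → MvPolynomial (Fin 1) ℂ) j).totalDegree : ℝ) *
      (eval (fun i => 2 * Real.pi * I * (q i : ℂ))
        (pderiv j (homogeneousComponent (p.toMvPolynomial (0 : Fin 1)).totalDegree
          (p.toMvPolynomial (0 : Fin 1))))).re < 0 := by
    rw [Fin.sum_univ_one, Matrix.cons_val_fin_one, totalDegree_toMvPolynomial_fin_one,
      eval_pderiv_leadingForm_toMvPolynomial_fin_one]
    simp only [hq]
    have e : p.leadingCoeff * (p.natDegree : ℂ) * (2 * Real.pi * I * (σ : ℂ)) ^ (p.natDegree - 1) =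
        (((2 * Real.pi) ^ (p.natDegree - 1) * p.natDegree : ℝ) : ℂ) * r := by
      rw [hr]
      push_cast
      ring
    rw [e, Complex.re_ofReal_mul]
    have hd : (0 : ℝ) < A.natDegree := by exact_mod_cast hA
    have hD : (0 : ℝ) < (2 * Real.pi) ^ (p.natDegree - 1) * p.natDegree := by
      have : (0 : ℝ) < p.natDegree := by exact_mod_cast (show 0 < p.natDegree by omega)
      positivity
    have : (2 * Real.pi) ^ (p.natDegree - 1) * p.natDegree * r.re < 0 := mul_neg_of_pos_of_neg hD hneg
    nlinarith
  have hA' : ∀ j : Fin 1, eval (fun i => 2 * Real.pi * I * (q i : ℂ))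
      (homogeneousComponent ((![A.toMvPolynomial (0 : Fin 1)] : Fin 1 → MvPolynomial (Fin 1) ℂ) j).totalDegree
        ((![A.toMvPolynomial (0 : Fin 1)] : Fin 1 → MvPolynomial (Fin 1) ℂ) j)) ≠ 0 := by
    intro j
    rw [Fin.fin_one_eq_zero j, Matrix.cons_val_fin_one]
    exact eval_leadingForm_toMvPolynomial_fin_one_ne_zero hA0 hv0
  exact unprojectedDense_polyFibredGraph_one_oscillatory (p.toMvPolynomial 0) (by rw [hdeg]; exact hp)
    q hre _ hA' hκ ![F]

/-- **Positive instances of the FREE typed question over oscillatory graph bases** (`deg p ≥ 2`,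
`lc(p)(σi)^{D-1} ∈ ℝ_{<0}`, `deg A ≥ 1`, any `F`): case ∧ free ∧ dense. (new)
[cite: MantovaMasser2023, §1 Further remarks] -/
theorem unprojectedDensityQuestion_instance_movingGraph_oscillatory {p : Polynomial ℂ}
    (hp : 2 ≤ p.natDegree) {σ : ℤ} (hσ : σ = 1 ∨ σ = -1)
    (him : (p.leadingCoeff * ((σ : ℂ) * I) ^ (p.natDegree - 1)).im = 0)
    (hneg : (p.leadingCoeff * ((σ : ℂ) * I) ^ (p.natDegree - 1)).re < 0)
    {A : Polynomial ℂ} (hA : 0 < A.natDegree) (F : MvPolynomial (Fin 2) ℂ) :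
    MMCaseDimPiOneFree (movingGraphSurface p A F) ∧
      IsMulFree ℂ 2 (movingGraphSurface p A F ∩ torusLocus ℂ 2) ∧
      UnprojectedDense (movingGraphSurface p A F) := by
  obtain ⟨h1, h2⟩ := mmCase_movingGraph_of_two_le hp hA F
  exact ⟨h1, h2, unprojectedDense_movingGraph_oscillatory hp hσ him hneg hA F⟩

/-- **The resonant parabola, de-resonated by a moving target.**  Seat 1's resonant base
`x₁ = x₀²/(2πi)` (`resonantPoly`): with the CONSTANT fibre `y₀ = 1` the exponential points are NOT
Zariski dense (`not_unprojectedDense_resonantParabola`); with the MOVING fibre `y₀ = x₀ + y₁` — the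
equation `e^{z} = z + e^{z²/(2πi)}` — they ARE (`σ = -1`: `lc · (-i) = -1/(2π) < 0`), and the surface
is in the case and free. (new) [cite: MantovaMasser2023, §1 Further remarks] -/
theorem unprojectedDense_resonantParabola_moving :
    MMCaseDimPiOneFree (movingGraphSurface resonantPoly Polynomial.X (C 1)) ∧
      IsMulFree ℂ 2 (movingGraphSurface resonantPoly Polynomial.X (C 1) ∩ torusLocus ℂ 2) ∧
      UnprojectedDense (movingGraphSurface resonantPoly Polynomial.X (C 1)) := by
  have hlc : resonantPoly.leadingCoeff = (2 * Real.pi * I)⁻¹ := by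
    rw [resonantPoly, Polynomial.leadingCoeff_C_mul_X_pow]
  have key : resonantPoly.leadingCoeff * (((-1 : ℤ) : ℂ) * I) ^ (resonantPoly.natDegree - 1) =
      (((-(2 * Real.pi)⁻¹ : ℝ)) : ℂ) := by
    rw [hlc, natDegree_resonantPoly, show (2 : ℕ) - 1 = 1 from rfl, pow_one, mul_inv, Complex.inv_I]
    push_cast
    linear_combination (2 * (Real.pi : ℂ))⁻¹ * Complex.I_sq
  refine unprojectedDensityQuestion_instance_movingGraph_oscillatory (by rw [natDegree_resonantPoly])
    (σ := -1) (Or.inr rfl) ?_ ?_ (by rw [Polynomial.natDegree_X]; exact one_pos) _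
  · rw [key, Complex.ofReal_im]
  · rw [key, Complex.ofReal_re]
    have := Real.pi_pos
    have : (0 : ℝ) < (2 * Real.pi)⁻¹ := by positivity
    linarith

/-- In particular `e^{z} = z + e^{z²/(2πi)}` has a solution. (new) -/
theorem exists_exp_eq_self_add_exp_resonant :
    ∃ z : ℂ, exp z = z + exp (resonantPoly.eval z) := by
  obtain ⟨-, -, hdense⟩ := unprojectedDense_resonantParabola_moving
  obtain ⟨h1, -⟩ := mmCase_movingGraph_of_two_le (by rw [natDegree_resonantPoly])
    (by rw [Polynomial.natDegree_X]; exact one_pos) (C 1 : MvPolynomial (Fin 2) ℂ) (p := resonantPoly)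
  obtain ⟨w, hwW, hwΓ⟩ := inter_expGraph_nonempty_of_vanishingIdeal_eq h1.2.1.left hdense
  refine ⟨w (Sum.inl 0), ?_⟩
  rw [mem_movingGraphSurface_iff] at hwW
  rw [mem_expGraph_iff] at hwΓ
  have h0 := hwΓ 0
  have h1' := hwΓ 1
  rw [Literature.ModelTheory.ExponentialFields.ExponentialRing.complex_exp_eq] at h0 h1'
  rw [← h0, hwW.2, h1', hwW.1, Polynomial.eval_X, map_one, map_one, mul_one]

end Univariate

end Summit.Schanuel.Schanuel.Theorems

end
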